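import Literature.NumberTheory.Transcendental.KZRulesAssociator

/-!
# `GammaHodgeSector` (stmt-KontsevichZagierPeriods-3742), line `koblitz-ogus-halving`: the
cancellation principle of the root-extraction reduction contains `π`-cancellation

The reduction `gammaHodgeSector_of_positiveCancellation`
(`…Theorems/TerasomaMultiplicationGammaHodgeSectorPowerIdentity.lean`) derives the crux from
`MultiplicationAccessible` and CANCELLATION BY EFFECTIVE CLASSES OF POSITIVE VALUE in the formal period
ring `P = FormalRep ⧸ relations`. That file shows the principle contains `BetaCancellation`
(stmt-13633) and is implied by the kernel form of Conjecture 1. This file records the other lower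
bound: it contains the open `π`-cancellation statement `KZ.PiCancellation` (stmt-0540 of route
AyoubSpecialisation; open in print even in its motivic shadow, Huber–Wüstholz 2022, App. A.4), since
`[π]` is an effective class of positive value. So the line's residual input is sandwiched
`PiCancellation ∧ BetaCancellation ≤ PositiveCancellation ≤ KZKernelConjecture`.
-/

noncomputable section

namespace Summit.KontsevichZagierPeriods.GammaHodgeSectorKO

open Literature.NumberTheory.Transcendental
open Literature.NumberTheory.Transcendental.KZ

/-- **Cancellation by effective classes of positive value contains `KZ.PiCancellation`**
(stmt-KontsevichZagierPeriods-0540): `[π] · c ∈ relations` reads `⟦[π]⟧ · ⟦c⟧ = 0` in `P`, and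
`value [π] = π > 0`. [folklore] -/
theorem piCancellation_of_positiveCancellation
    (hC : ∀ ⦃d : ℕ⦄ (σ : IntegralRep d) (z : FormalPeriodRing), 0 < σ.value →
      toFormalPeriod (of σ) * z = 0 → z = 0) :
    PiCancellation := by
  intro c hc
  have h1 : toFormalPeriod (of piRep) * toFormalPeriod c = 0 := by
    rw [← map_mul, toFormalPeriod_eq_zero_iff]
    exact hc
  have h2 := hC piRep _ (by rw [piRep_value]; exact Real.pi_pos) h1
  rwa [toFormalPeriod_eq_zero_iff] at h2

end Summit.KontsevichZagierPeriods.GammaHodgeSectorKO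

end
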